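import Literature.MathematicalPhysics.QuantumLattice.InfVolFermionStateTorusLimitKMSMomentCuts
import Literature.Analysis.ValidatedNumerics.ExpPolynomialLineNonneg
import HarnessLib

/-!
# KMS moment rows, V: the end-to-end reader — a whole-line positivity certificate for the exponential
# polynomial discharges the scalar KMS moment row of every thermal torus-limit state

Topic `Literature/MathematicalPhysics/QuantumLattice`; glue between the kernel rows of
`InfVolFermionStateTorusLimitKMSMomentCuts.lean` / `GibbsKMSMomentCutsSector.lean` (scalar KMS moment rows,
hypothesis `∀ u, 0 ≤ Σ_k p_k u^k + e^{−u} Σ_k q_k u^k` on the WHOLE real line) and the certificate format of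
`Literature/Analysis/ValidatedNumerics/ExpPolynomialLineNonneg.lean` (the same inequality for rational
coefficient LISTS `lp, lq : ExpPoly.Poly`, proved from a tails-and-leaves certificate decided by the kernel).
With `p_k = lp[k]`, `q_k = lq[k]` (`List.getD · k 0`, lists of length `≤ K + 1`):

* `IsTorusLimitOfMixture.re_expect_momentRow_nonneg_of_sectorGibbs_of_lineCert` — for every torus limit `ω` of
  the canonical sector Gibbs states of the `t–t'` Hubbard model at inverse temperature `β`, every local generator
  `a ∈ 𝔄_Λ` commuting with the local `N` and `S^z`, every window `Λ' ⊇ (thicken · 1)^[K] Λ`: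
  `0 ≤ Re ω_{Λ'}(Σ_k β^k [lp[k] · (Γa)ᴴ ad_{H_{Λ'}}^k(Γa) + lq[k] · ad_{H_{Λ'}}^k(Γa) (Γa)ᴴ])`;
* `sum_canonicalWeight_mul_re_expect_momentRow_nonneg_of_lineCert` — the same row for the canonical sector Gibbs
  eigen-mixture of any finite Hermitian `A` (clusters), and `sum_exp_mul_re_expect_momentRow_nonneg_of_lineCert`
  (full space).

So a row file carries: the generator word, `K`, the window inclusion (decided on finsets), the two rational lists,
and ONE application of `expPolyLine_nonneg_of_pieces` (two tail lemmas with `decide +kernel` coefficient checks +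
`expPolyLine_pos_of_pLeavesCheck` with a kernel-decided leaf list). Everything is PROVED; no definition, no
named fact.

## References

* C. Itoi, H. Ishimori, K. Sato, Y. Sakamoto, J. Phys. Soc. Jpn. 92 (2023) 074001 = arXiv:2306.03489, Thm. 3,
  Lemma 6. [cite: ItoiEtAl2023, Theorem 3]
* H. Fawzi, O. Fawzi, S. O. Scalet, Nat. Commun. 15 (2024) 7394 = arXiv:2311.18706, §3.1–§3.2.
  [cite: FawziFawziScalet2024, Thm. 3.1]
* K. Makino, M. Berz, Int. J. Pure Appl. Math. 4 (2003) 379–456, Algorithm 2. [cite: MakinoBerz2003, Algorithm 2]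
-/

noncomputable section

namespace Literature.MathematicalPhysics.QuantumLattice

open Matrix Finset HubbardWave0 Literature.Probability.LatticeModels ThermodynamicLimit
open Literature.Analysis.ValidatedNumerics Literature.Analysis.ValidatedNumerics.ExpPoly
open _root_.Filter
open scoped _root_.Topology ComplexOrder BigOperators

/-! ### §1 Finite volume -/

section Finite

variable {κ : Type*} [Fintype κ] [DecidableEq κ]

/-- **Scalar KMS moment row of a Gibbs eigen-mixture from a line certificate** (full space): lists `lp, lq` of
length `≤ K + 1` with `0 ≤ lp(u) + e^{−u} lq(u)` for all real `u` give the row with coefficients `p_k = lp[k]`,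
`q_k = lq[k]`. [cite: ItoiEtAl2023, Theorem 3] -/
theorem sum_exp_mul_re_expect_momentRow_nonneg_of_lineCert {H : Matrix κ κ ℂ} (hH : H.IsHermitian)
    (a : Matrix κ κ ℂ) (β : ℝ) {K : ℕ} {lp lq : Poly} (hp : lp.length ≤ K + 1) (hq : lq.length ≤ K + 1)
    (hline : ∀ u : ℝ, 0 ≤ Poly.eval lp u + Real.exp (-u) * Poly.eval lq u) :
    0 ≤ ∑ c, Real.exp (-(β * hH.eigenvalues c)) *
      (star (fun i => (hH.eigenvectorUnitary : Matrix κ κ ℂ) i c) ⬝ᵥ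
        ((∑ k : Fin (K + 1),
            ((((β ^ (k : ℕ) * ((lp.getD (k : ℕ) 0 : ℚ) : ℝ) : ℝ) : ℂ)) •
                (aᴴ * (fun X : Matrix κ κ ℂ => H * X - X * H)^[(k : ℕ)] a) +
              (((β ^ (k : ℕ) * ((lq.getD (k : ℕ) 0 : ℚ) : ℝ) : ℝ) : ℂ)) •
                ((fun X : Matrix κ κ ℂ => H * X - X * H)^[(k : ℕ)] a * aᴴ))) *ᵥ
          fun i => (hH.eigenvectorUnitary : Matrix κ κ ℂ) i c)).re :=
  sum_exp_mul_re_expect_momentRow_nonneg hH a β (p := fun k => ((lp.getD (k : ℕ) 0 : ℚ) : ℝ))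
    (q := fun k => ((lq.getD (k : ℕ) 0 : ℚ) : ℝ)) (momentRow_hyp_of_expPolyLine_nonneg hp hq hline)

variable {ι : Type*} [Fintype ι] [DecidableEq ι] (p : ι → Prop) [DecidablePred p]

/-- **Scalar KMS moment row of a canonical SECTOR Gibbs eigen-mixture from a line certificate** (clusters: `A`
Hermitian, block diagonal for the sector; `a`, `aᴴ` sector preserving). [cite: ItoiEtAl2023, Theorem 3] -/
theorem sum_canonicalWeight_mul_re_expect_momentRow_nonneg_of_lineCert {A : Matrix ι ι ℂ} (hA : A.IsHermitian)
    (hinv : ∀ i j, ¬ p i → p j → A i j = 0) {a : Matrix ι ι ℂ}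
    (ha : ∀ i j, ¬ p i → p j → a i j = 0) (ha' : ∀ i j, ¬ p i → p j → aᴴ i j = 0)
    (β : ℝ) {K : ℕ} {lp lq : Poly} (hp : lp.length ≤ K + 1) (hq : lq.length ≤ K + 1)
    (hline : ∀ u : ℝ, 0 ≤ Poly.eval lp u + Real.exp (-u) * Poly.eval lq u) :
    0 ≤ ∑ c, canonicalWeight β (sectorEigenvalue p A hA) c *
      (star (sectorEigenvector p A hA c) ⬝ᵥ
        ((∑ k : Fin (K + 1),
            ((((β ^ (k : ℕ) * ((lp.getD (k : ℕ) 0 : ℚ) : ℝ) : ℝ) : ℂ)) •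
                (aᴴ * (fun X : Matrix ι ι ℂ => A * X - X * A)^[(k : ℕ)] a) +
              (((β ^ (k : ℕ) * ((lq.getD (k : ℕ) 0 : ℚ) : ℝ) : ℝ) : ℂ)) •
                ((fun X : Matrix ι ι ℂ => A * X - X * A)^[(k : ℕ)] a * aᴴ))) *ᵥ
          sectorEigenvector p A hA c)).re :=
  sum_canonicalWeight_mul_re_expect_momentRow_nonneg p hA hinv ha ha' β
    (p' := fun k => ((lp.getD (k : ℕ) 0 : ℚ) : ℝ)) (q' := fun k => ((lq.getD (k : ℕ) 0 : ℚ) : ℝ))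
    (momentRow_hyp_of_expPolyLine_nonneg hp hq hline)

end Finite

/-! ### §2 Thermal torus-limit states of the `t–t'` Hubbard model -/

namespace InfVolFermionState

/-- **Scalar KMS moment row of a thermal torus limit from a line certificate.** For every torus limit `ω` of the
canonical sector Gibbs states of `hubbardTorusTT' (Ls j) t t' U` at inverse temperature `β` on `(rectN n ·, S^z = 0)`
along `Ls → ∞`, every local generator `a ∈ 𝔄_Λ` commuting with the local `N` and `S^z`, every window
`Λ' ⊇ (thicken · 1)^[K] Λ`, and all rational lists `lp, lq` of length `≤ K + 1` whose exponential polynomial is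
nonnegative on the whole line (`ExpPolynomialLineNonneg.lean` certificate):
`0 ≤ Re ω_{Λ'}(Σ_k β^k [lp[k] · (Γa)ᴴ ad_{H^{tt'}_{Λ'}}^k(Γa) + lq[k] · ad_{H^{tt'}_{Λ'}}^k(Γa) (Γa)ᴴ])`.
[cite: ItoiEtAl2023, Theorem 3] [cite: FawziFawziScalet2024, Thm. 3.1] -/
theorem IsTorusLimitOfMixture.re_expect_momentRow_nonneg_of_sectorGibbs_of_lineCert
    (t t' U : ℝ) {n : ℝ} (β : ℝ) {ω : InfVolFermionState 2} {Ls : ℕ → ℕ}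
    (h : ω.IsTorusLimitOfMixture (sectorGibbsCount n) (fun L => sectorGibbsWeightTT' β t t' U n L)
      (fun L => sectorGibbsVectorTT' t t' U n L) Ls)
    (hLs : Tendsto Ls atTop atTop) {Λ Λ' : Finset (Site 2)} (hΛ : Λ ⊆ Λ') {K : ℕ}
    (hK : (fun S : Finset (Site 2) => thicken S 1)^[K] Λ ⊆ Λ')
    {a : FermionOp Λ} (haN : Commute a totalNumber) (haS : Commute a HubbardWave0.spinZ)
    {lp lq : Poly} (hp : lp.length ≤ K + 1) (hq : lq.length ≤ K + 1)
    (hline : ∀ u : ℝ, 0 ≤ Poly.eval lp u + Real.exp (-u) * Poly.eval lq u) :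
    0 ≤ (ω.expect Λ'
      (∑ k : Fin (K + 1),
        ((((β ^ (k : ℕ) * ((lp.getD (k : ℕ) 0 : ℚ) : ℝ) : ℝ) : ℂ)) • ((fermionEmbed (PolySite.incl hΛ) a)ᴴ *
            (fun Y : FermionOp Λ' => (hubbardTTPrimeFermionInteraction t t' U).localHamiltonian Λ' * Y -
                Y * (hubbardTTPrimeFermionInteraction t t' U).localHamiltonian Λ')^[(k : ℕ)]
              (fermionEmbed (PolySite.incl hΛ) a)) +
          (((β ^ (k : ℕ) * ((lq.getD (k : ℕ) 0 : ℚ) : ℝ) : ℝ) : ℂ)) •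
            ((fun Y : FermionOp Λ' => (hubbardTTPrimeFermionInteraction t t' U).localHamiltonian Λ' * Y -
                Y * (hubbardTTPrimeFermionInteraction t t' U).localHamiltonian Λ')^[(k : ℕ)]
              (fermionEmbed (PolySite.incl hΛ) a) * (fermionEmbed (PolySite.incl hΛ) a)ᴴ)))).re :=
  h.re_expect_momentRow_nonneg_of_sectorGibbs t t' U β hLs hΛ hK haN haS
    (p := fun k => ((lp.getD (k : ℕ) 0 : ℚ) : ℝ)) (q := fun k => ((lq.getD (k : ℕ) 0 : ℚ) : ℝ))
    (momentRow_hyp_of_expPolyLine_nonneg hp hq hline)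

/-- **The worked instance, end to end**: the Itoi–Ishimori–Sato–Sakamoto `K = 2` row with slack `1/100`,
`lp = [1/100, −1, ½]`, `lq = [1/100, 1, ½]` (certified on the whole line by `expPolyLine_nonneg_itoi_slack`), holds
in every thermal torus limit for every admissible generator and window `Λ' ⊇ thicken (thicken Λ 1) 1`:
`0 ≤ Re ω_{Λ'}(Σ_{k≤2} β^k [lp[k] (Γa)ᴴ ad^k(Γa) + lq[k] ad^k(Γa)(Γa)ᴴ])`, i.e.
`β⟨(Γa)ᴴ[H,Γa] − [H,Γa](Γa)ᴴ⟩ ≤ (β²/2)⟨(Γa)ᴴ[H,[H,Γa]] + [H,[H,Γa]](Γa)ᴴ⟩ + (⟨(Γa)ᴴΓa + Γa(Γa)ᴴ⟩)/100`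
in the sign convention `ad_H X = HX − XH`. [cite: ItoiEtAl2023, Theorem 3] -/
theorem IsTorusLimitOfMixture.re_expect_itoiRow_slack_nonneg_of_sectorGibbs
    (t t' U : ℝ) {n : ℝ} (β : ℝ) {ω : InfVolFermionState 2} {Ls : ℕ → ℕ}
    (h : ω.IsTorusLimitOfMixture (sectorGibbsCount n) (fun L => sectorGibbsWeightTT' β t t' U n L)
      (fun L => sectorGibbsVectorTT' t t' U n L) Ls)
    (hLs : Tendsto Ls atTop atTop) {Λ Λ' : Finset (Site 2)} (hΛ : Λ ⊆ Λ')
    (hK : (fun S : Finset (Site 2) => thicken S 1)^[2] Λ ⊆ Λ')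
    {a : FermionOp Λ} (haN : Commute a totalNumber) (haS : Commute a HubbardWave0.spinZ) :
    0 ≤ (ω.expect Λ'
      (∑ k : Fin (2 + 1),
        ((((β ^ (k : ℕ) * ((([1/100, -1, 1/2] : Poly).getD (k : ℕ) 0 : ℚ) : ℝ) : ℝ) : ℂ)) •
            ((fermionEmbed (PolySite.incl hΛ) a)ᴴ *
              (fun Y : FermionOp Λ' => (hubbardTTPrimeFermionInteraction t t' U).localHamiltonian Λ' * Y -
                  Y * (hubbardTTPrimeFermionInteraction t t' U).localHamiltonian Λ')^[(k : ℕ)]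
                (fermionEmbed (PolySite.incl hΛ) a)) +
          (((β ^ (k : ℕ) * ((([1/100, 1, 1/2] : Poly).getD (k : ℕ) 0 : ℚ) : ℝ) : ℝ) : ℂ)) •
            ((fun Y : FermionOp Λ' => (hubbardTTPrimeFermionInteraction t t' U).localHamiltonian Λ' * Y -
                Y * (hubbardTTPrimeFermionInteraction t t' U).localHamiltonian Λ')^[(k : ℕ)]
              (fermionEmbed (PolySite.incl hΛ) a) * (fermionEmbed (PolySite.incl hΛ) a)ᴴ)))).re :=
  h.re_expect_momentRow_nonneg_of_sectorGibbs_of_lineCert t t' U β hLs hΛ hK haN haS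
    (lp := [1/100, -1, 1/2]) (lq := [1/100, 1, 1/2]) (by simp) (by simp) expPolyLine_nonneg_itoi_slack

end InfVolFermionState

end Literature.MathematicalPhysics.QuantumLattice

end
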